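import Summits.RiemannHypothesis.RiemannHypothesis.Theses.WeilPos
import Summits.RiemannHypothesis.RiemannHypothesis.Theorems.WeilPositivityLogTwo
import HarnessLib

/-!
# Route WeilPos, crux `WeilposSlackRungLog2` (stmt-RiemannHypothesis-18182): the unit-slack two-prime rung — PROVED

`Summit.RiemannHypothesis.RiemannHypothesis.Theses.WeilPos.WeilposSlackRungLog2`: for every Weil test function `g`
supported in `[−log 2, log 2]` (exactly the prime powers `2, 3` enter `W(g ⋆ g̃)`; `4` sits on the boundary where the
kernel vanishes), `−‖g‖₂² ≤ Re W(g ⋆ g̃)`, i.e. Bombieri's ground energy satisfies `ε(log 2) ≥ −1`.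

When the item was filed (2026-08-17) no certificate at `b = log 2` existed.  Since 2026-08-21 the EXACT rung is a
theorem of the tree: `EvenWinsBeyondArch.weilPositivityOn_log_two : WeilPositivityOn (Real.log 2)`
(`Theorems/WeilPositivityLogTwo.lean`, from the GroundBarta parity blocks at `18/25 ≥ log 2`, RH-free), i.e.
`0 ≤ Re W(g ⋆ g̃)` on this window; the slack rung follows because `−‖g‖₂² ≤ 0`.
-/

set_option linter.dupNamespace false

noncomputable section

namespace Summit.RiemannHypothesis.RiemannHypothesis.Theorems

open MeasureTheory

/-- **Unit-slack Weil positivity on the two-prime window** (route WeilPos crux `WeilposSlackRungLog2`):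
`−∫‖g‖² ≤ Re W(g ⋆ g̃)` for every Weil test function `g` with `tsupport g ⊆ [−log 2, log 2]` — from the exact
rung `WeilPositivityOn (log 2)` (`EvenWinsBeyondArch.weilPositivityOn_log_two`) and `−‖g‖₂² ≤ 0`.
[cite: Bombieri2000Weil, §4 (ground energy ε(a)); rung: tree theorem weilPositivityOn_log_two] -/
theorem WeilposSlackRungLog2_proof :
    Summit.RiemannHypothesis.RiemannHypothesis.Theses.WeilPos.WeilposSlackRungLog2 := by
  unfold Summit.RiemannHypothesis.RiemannHypothesis.Theses.WeilPos.WeilposSlackRungLog2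
  intro g hg hsupp
  have h0 : 0 ≤ (Literature.NumberTheory.LFunctions.weilQuadratic g).re :=
    EvenWinsBeyondArch.weilPositivityOn_log_two g hg hsupp
  have h1 : 0 ≤ ∫ t, ‖g t‖ ^ 2 := integral_nonneg fun t ↦ by positivity
  linarith

end Summit.RiemannHypothesis.RiemannHypothesis.Theorems

end
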